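import Summits.CriticalPhenomena.PercolationContinuityZ3.Theorems.PercNearOneGluingNoHeavyLowerTailSahiDeepCoreEGC
import Mathlib.Tactic.Linarith
import Mathlib.Tactic.Ring
import HarnessLib

/-!
# `NoHeavyLowerTail` (crux stmt-CriticalPhenomena-4575), master-family line P1 (gen 13):
# the HOMOGENEOUS strong cubic functional `(κ+o)(κo − e₂) − e₃`, conjecture S₃⁺ ⊂ S₃, and the kernel links
# `S₃⁺ ⟹ S₃ ⟹ class law`, and the majority/none/only (generator) form of the cells

Support file (seat `prim-masterthm-p1`, gen 13; `--supports stmt-CriticalPhenomena-4575`).  Two definitions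
(`strongCubicPlus`, the typed conjecture `StrongCubicPlusNonneg`), no `sorry`, standard axioms.  Memo
`run/shared/lean/prim/prim-masterthm/FROM-prim-masterthm-p1-g13-CP3PLUS.md` §1–§3.

SETTING (tree `SahiDeepCore`): a sandwiched triple `(A,B,N)` of up-sets (`A∖B ⊆ N`, `B∖A ⊆ N`, `N ⊆ A∪B`) has the five
cells `A∖B, B∖A, (A∩B)∖N` (the three PETALS, masses `α, β, d`), `K = A∩B∩N` (core, `κ`), `O = (A∪B)ᶜ` (outside, `o`).
The seat's conjecture S₃ (gen 10, `strongCubic ≥ 0`) is `κo − e₂ − e₃ ≥ 0` with `e₂ = αβ+αd+βd`, `e₃ = αβd`.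

NEW HERE.
* `strongCubicPlus := (κ + o)·(κo − e₂) − e₃` — the measure shadow of the COMB statement CP3⁺ of the memo (coefficientwise
  positivity of the homogeneous cubic form `(g_K+g_O)(g_K g_O − e₂(g)) − g₁g₂g₃`; exact census: every 3-cell system on
  ≤ 5 coordinates, every tensor-Bernstein coefficient — 37 149 696 instances — and ≈ 5·10⁵ adversarial/composite instances
  on 6–8 coordinates, 0 failures).  Since `κ + o = 1 − (α+β+d) ≤ 1`, **S₃⁺ : `strongCubicPlus ≥ 0` is STRONGER than S₃**:
  `strongCubic = strongCubicPlus + (α+β+d)(κo − e₂)` (`strongCubic_eq_plus_add`) and `κo ≥ e₂` is Gladkov's theorem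
  (`gladkov_cells`, tree `inter_diff_harris`), whence `strongCubicPlus ≤ strongCubic` (`strongCubicPlus_le_strongCubic`).
* the typed conjecture `StrongCubicPlusNonneg p` and the kernel links `S₃⁺ ⟹ S₃ ⟹` Sahi's `C₃` on every sandwiched
  increasing triple / every co-sunflower `(G₂∪G₃, G₁∪G₃, G₁∪G₂)` (`strongCubic_nonneg_of_plus`, `classLaw_of_plus`,
  `coSunflower_nonneg_of_plus`).
* GENERATOR (MAJORITY/NONE/ONLY) FORM (`coSunflower_coreOutside`, `strongCubicPlus_coSunflower`): the core and the outside
  of the co-sunflower `(G₂∪G₃, G₁∪G₃, G₁∪G₂)` of ANY three increasing events are "at least two `G_i` occur" and "no `G_i`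
  occurs" (the petals are "only `G_i` occurs", tree `coSunflower_privateParts`), so every 3-cell Gladkov system is the
  ≥2 / only-`i` / none decomposition of a triple of increasing events and S₃⁺ reads
  `(P(≥2)+P(none))·(P(≥2)·P(none) − e₂(P(only G_i))) ≥ ∏ P(only G_i)`.
HONEST FRAMING: typed conjecture + reductions; S₃⁺, S₃ and the class law remain OPEN.  S₃⁺ is asymptotically sharp (Poisson
regime of the standard example) and equals `p⁵q³(1+2q) ≥ 0` on the standard 3-coordinate system. [this work]
-/

noncomputable section

open scoped Classical

namespace Summit.CriticalPhenomena.PercolationContinuityZ3.Theorems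

namespace SahiDeepCore

open Literature.Combinatorics.Sahi2008
open Literature.Probability.Percolation (DeterminedBy determinedBy_iff)
open Literature.Probability.Percolation.DecisionTree (ind ind_of_mem ind_of_not_mem ind_nonneg)

variable {ι : Type} [Fintype ι]

local notation3 (prettyPrint := false) "m⟦" p ", " X "⟧" => ex (bernoulliWeight p) (ind X)

/-! ### 1. The homogeneous strong cubic functional -/

/-- **The homogeneous strong cubic functional** `(κ + o)·(κ·o − (αβ + αd + βd)) − αβd` of a sandwiched triple, in the five
cell masses `α = μ(A∖B)`, `β = μ(B∖A)`, `κ = μ(A∩B∩N)`, `d = μ((A∩B)∖N)`, `o = μ((A∪B)ᶜ)`.  Conjecturally nonnegative (S₃⁺);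
it is the measure shadow of the comb conjecture CP3⁺ of the memo. [this work] -/
def strongCubicPlus (p : ι → unitInterval) (A B N : Set (Set ι)) : ℝ :=
  (m⟦p, A ∩ B ∩ N⟧ + m⟦p, (A ∪ B)ᶜ⟧) *
      (m⟦p, A ∩ B ∩ N⟧ * m⟦p, (A ∪ B)ᶜ⟧
        - (m⟦p, A \ B⟧ * m⟦p, B \ A⟧ + m⟦p, A \ B⟧ * m⟦p, (A ∩ B) \ N⟧ + m⟦p, B \ A⟧ * m⟦p, (A ∩ B) \ N⟧))
    - m⟦p, A \ B⟧ * m⟦p, B \ A⟧ * m⟦p, (A ∩ B) \ N⟧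

/-- **`F_S = F_S⁺ + (α+β+d)·(κo − e₂)`**: the strong cubic functional is the homogeneous one plus the petal mass times
Gladkov's defect (uses only `α+β+κ+d+o = 1`). [this work] -/
theorem strongCubic_eq_plus_add (p : ι → unitInterval) (A B N : Set (Set ι)) :
    strongCubic p A B N = strongCubicPlus p A B N
      + (m⟦p, A \ B⟧ + m⟦p, B \ A⟧ + m⟦p, (A ∩ B) \ N⟧) *
        (m⟦p, A ∩ B ∩ N⟧ * m⟦p, (A ∪ B)ᶜ⟧
          - (m⟦p, A \ B⟧ * m⟦p, B \ A⟧ + m⟦p, A \ B⟧ * m⟦p, (A ∩ B) \ N⟧ + m⟦p, B \ A⟧ * m⟦p, (A ∩ B) \ N⟧)) := by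
  have hsum := cells_sum_eq_one p A B N
  have ho : m⟦p, (A ∪ B)ᶜ⟧ = 1 - (m⟦p, A \ B⟧ + m⟦p, B \ A⟧ + m⟦p, A ∩ B ∩ N⟧ + m⟦p, (A ∩ B) \ N⟧) := by linarith
  simp only [strongCubic, strongCubicPlus]
  rw [ho]
  ring

/-- **Gladkov's inequality in cells**: `κ·o ≥ αβ + αd + βd` for every sandwiched triple of up-sets (tree `inter_diff_harris`,
i.e. Gladkov 2024 Thm. 2.1 with three cells, rewritten in the five cells). [cite: Gladkov2024StrongFKG, Thm. 2.1 (k = 3)] -/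
theorem gladkov_cells (p : ι → unitInterval) {A B N : Set (Set ι)} (hA : IsUpperSet A) (hB : IsUpperSet B)
    (hNup : IsUpperSet N) (hAB : A \ B ⊆ N) (hBA : B \ A ⊆ N) (hN : N ⊆ A ∪ B) :
    m⟦p, A \ B⟧ * m⟦p, B \ A⟧ + m⟦p, A \ B⟧ * m⟦p, (A ∩ B) \ N⟧ + m⟦p, B \ A⟧ * m⟦p, (A ∩ B) \ N⟧
      ≤ m⟦p, A ∩ B ∩ N⟧ * m⟦p, (A ∪ B)ᶜ⟧ := by
  have hG := inter_diff_harris p hA hB hNup hAB hBA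
  obtain ⟨hAe, hT⟩ := cells_of_sandwich p hAB hN
  have hN' : N ⊆ B ∪ A := fun ω h => (hN h).symm
  obtain ⟨hBe, hT'⟩ := cells_of_sandwich p hBA hN'
  rw [Set.inter_comm B A] at hBe hT'
  have hsum := cells_sum_eq_one p A B N
  rw [hAe, hBe, hT] at hG
  have ho' : m⟦p, (A ∪ B)ᶜ⟧ = 1 - (m⟦p, A \ B⟧ + m⟦p, B \ A⟧ + m⟦p, A ∩ B ∩ N⟧ + m⟦p, (A ∩ B) \ N⟧) := by
    linarith
  have key : m⟦p, A ∩ B ∩ N⟧ * (1 - (m⟦p, A \ B⟧ + m⟦p, B \ A⟧ + m⟦p, A ∩ B ∩ N⟧ + m⟦p, (A ∩ B) \ N⟧))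
      - (m⟦p, A \ B⟧ * m⟦p, B \ A⟧ + m⟦p, A \ B⟧ * m⟦p, (A ∩ B) \ N⟧ + m⟦p, B \ A⟧ * m⟦p, (A ∩ B) \ N⟧)
      = (m⟦p, A ∩ B ∩ N⟧ + m⟦p, (A ∩ B) \ N⟧
          - (m⟦p, A \ B⟧ + m⟦p, A ∩ B ∩ N⟧ + m⟦p, (A ∩ B) \ N⟧) * (m⟦p, B \ A⟧ + m⟦p, A ∩ B ∩ N⟧ + m⟦p, (A ∩ B) \ N⟧))
        - m⟦p, (A ∩ B) \ N⟧ * (1 - (m⟦p, A ∩ B ∩ N⟧ + m⟦p, (A ∩ B) \ N⟧)) := by ring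
  have : 0 ≤ m⟦p, A ∩ B ∩ N⟧ * m⟦p, (A ∪ B)ᶜ⟧
      - (m⟦p, A \ B⟧ * m⟦p, B \ A⟧ + m⟦p, A \ B⟧ * m⟦p, (A ∩ B) \ N⟧ + m⟦p, B \ A⟧ * m⟦p, (A ∩ B) \ N⟧) := by
    rw [ho', key]; linarith
  linarith

/-- **`F_S⁺ ≤ F_S`**: the homogeneous functional is the smaller one (Gladkov's defect times the petal mass is nonnegative),
so S₃⁺ is a STRENGTHENING of S₃. [this work] -/
theorem strongCubicPlus_le_strongCubic (p : ι → unitInterval) {A B N : Set (Set ι)} (hA : IsUpperSet A) (hB : IsUpperSet B)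
    (hNup : IsUpperSet N) (hAB : A \ B ⊆ N) (hBA : B \ A ⊆ N) (hN : N ⊆ A ∪ B) :
    strongCubicPlus p A B N ≤ strongCubic p A B N := by
  rw [strongCubic_eq_plus_add]
  have hpet : 0 ≤ m⟦p, A \ B⟧ + m⟦p, B \ A⟧ + m⟦p, (A ∩ B) \ N⟧ := by
    have h1 : 0 ≤ m⟦p, A \ B⟧ := ex_nonneg (isFKGMeasure_bernoulliWeight p).nonneg fun ω => ind_nonneg _ ω
    have h2 : 0 ≤ m⟦p, B \ A⟧ := ex_nonneg (isFKGMeasure_bernoulliWeight p).nonneg fun ω => ind_nonneg _ ω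
    have h3 : 0 ≤ m⟦p, (A ∩ B) \ N⟧ := ex_nonneg (isFKGMeasure_bernoulliWeight p).nonneg fun ω => ind_nonneg _ ω
    linarith
  have hgl := gladkov_cells p hA hB hNup hAB hBA hN
  nlinarith [mul_nonneg hpet (sub_nonneg.2 hgl)]

/-! ### 2. The typed conjecture S₃⁺ and the kernel links -/

/-- **CONJECTURE S₃⁺ (homogeneous strong cubic inequality; typed).**  For every sandwiched increasing triple `(A, B, N)`
determined by a finite coordinate set: `(κ+o)(κo − e₂) ≥ e₃` in the five cells.  It is the measure shadow of the comb
conjecture CP3⁺ (memo §1): exact census on ≤ 5 coordinates (all 37 149 696 tensor-Bernstein coefficients of all 1 160 928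
three-cell systems on `2^5`), adversarial/composite census on 6–8 coordinates, 0 failures; tight exactly on the compositions of
the standard 3-coordinate example found so far.  Implies S₃ (`strongCubic_nonneg_of_plus`). [this work] [status: open] -/
@[conjecture] def StrongCubicPlusNonneg (p : ι → unitInterval) : Prop :=
  ∀ (S : Finset ι) (A B N : Set (Set ι)), IsUpperSet A → IsUpperSet B → IsUpperSet N →
    A \ B ⊆ N → B \ A ⊆ N → N ⊆ A ∪ B →
    DeterminedBy A (↑S : Set ι) → DeterminedBy B (↑S : Set ι) → DeterminedBy N (↑S : Set ι) →
    0 ≤ strongCubicPlus p A B N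

omit [Fintype ι] in
/-- Every event on a finite index type is determined by `univ`. [folklore] -/
private theorem determinedBy_univ'' [Fintype ι] (X : Set (Set ι)) :
    DeterminedBy X (↑(Finset.univ : Finset ι) : Set ι) := by
  rw [determinedBy_iff]; intro ω ω' h; simp only [Finset.coe_univ, Set.inter_univ] at h; rw [h]

/-- **S₃⁺ ⟹ S₃** (`strongCubic ≥ 0` for every sandwiched increasing triple). [this work] -/
theorem strongCubic_nonneg_of_plus (p : ι → unitInterval) (h : StrongCubicPlusNonneg p) {A B N : Set (Set ι)}
    (hA : IsUpperSet A) (hB : IsUpperSet B) (hN : IsUpperSet N) (hAB : A \ B ⊆ N) (hBA : B \ A ⊆ N) (hNs : N ⊆ A ∪ B) :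
    0 ≤ strongCubic p A B N :=
  le_trans (h Finset.univ A B N hA hB hN hAB hBA hNs (determinedBy_univ'' A) (determinedBy_univ'' B) (determinedBy_univ'' N))
    (strongCubicPlus_le_strongCubic p hA hB hN hAB hBA hNs)

/-- **S₃⁺ ⟹ the co-sunflower class law** (Sahi's `C₃` for every sandwiched increasing triple; via `E₃ ≥ F_S ≥ F_S⁺`). [this work] -/
theorem classLaw_of_plus (p : ι → unitInterval) (h : StrongCubicPlusNonneg p) {A B N : Set (Set ι)}
    (hA : IsUpperSet A) (hB : IsUpperSet B) (hN : IsUpperSet N) (hAB : A \ B ⊆ N) (hBA : B \ A ⊆ N) (hNs : N ⊆ A ∪ B) :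
    0 ≤ sahiE (bernoulliWeight p) 3 ![ind A, ind B, ind N] :=
  le_trans (strongCubic_nonneg_of_plus p h hA hB hN hAB hBA hNs) (sahiE_three_ge_strongCubic p hA hB hN hAB hBA hNs)

/-- **S₃⁺ ⟹ `E₃(G₂∪G₃, G₁∪G₃, G₁∪G₂) ≥ 0`** for all increasing `G_i` (the T-row / AT₃ on the class). [this work] -/
theorem coSunflower_nonneg_of_plus (p : ι → unitInterval) (h : StrongCubicPlusNonneg p) {G₁ G₂ G₃ : Set (Set ι)}
    (h₁ : IsUpperSet G₁) (h₂ : IsUpperSet G₂) (h₃ : IsUpperSet G₃) :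
    0 ≤ sahiE (bernoulliWeight p) 3 ![ind (G₂ ∪ G₃), ind (G₁ ∪ G₃), ind (G₁ ∪ G₂)] := by
  obtain ⟨s1, s2, s3⟩ := coSunflower_sandwich G₁ G₂ G₃
  exact classLaw_of_plus p h (h₂.union h₃) (h₁.union h₃) (h₁.union h₂) s1 s2 s3

/-! ### 3. Generator (majority / none / only) form of the cells of a co-sunflower -/

omit [Fintype ι] in
/-- **Core and outside of a co-sunflower in generator form.**  For ANY three events `G₁, G₂, G₃`, the core of the sandwiched
triple `(G₂∪G₃, G₁∪G₃, G₁∪G₂)` is the majority event `(G₁∩G₂) ∪ (G₁∩G₃) ∪ (G₂∩G₃)` ("at least two occur") and its outside is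
`(G₁∪G₂∪G₃)ᶜ` ("none occurs"); with `coSunflower_privateParts` (petals = "only `G_i` occurs") this exhibits EVERY 3-cell
Gladkov system as the ≥2 / only-`i` / none decomposition of a triple of increasing events, so that S₃⁺ reads
`(P(≥2) + P(none))·(P(≥2)·P(none) − e₂(P(only G_i))) ≥ ∏ P(only G_i)`. [this work] -/
theorem coSunflower_coreOutside (G₁ G₂ G₃ : Set (Set ι)) :
    (G₂ ∪ G₃) ∩ (G₁ ∪ G₃) ∩ (G₁ ∪ G₂) = (G₁ ∩ G₂) ∪ (G₁ ∩ G₃) ∪ (G₂ ∩ G₃) ∧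
      ((G₂ ∪ G₃) ∪ (G₁ ∪ G₃))ᶜ = (G₁ ∪ G₂ ∪ G₃)ᶜ := by
  refine ⟨Set.ext fun ω => ?_, Set.ext fun ω => ?_⟩
  · simp only [Set.mem_inter_iff, Set.mem_union]; tauto
  · simp only [Set.mem_compl_iff, Set.mem_union]; tauto

/-- **S₃⁺ in generator form**: for the co-sunflower of `G₁, G₂, G₃`, `strongCubicPlus` is
`(m + z)(m·z − e₂(u)) − u₁u₂u₃` with `m = P(≥2 of the G_i)`, `z = P(none)`, `u_i = P(only G_i)`. [this work] -/
theorem strongCubicPlus_coSunflower (p : ι → unitInterval) (G₁ G₂ G₃ : Set (Set ι)) :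
    strongCubicPlus p (G₂ ∪ G₃) (G₁ ∪ G₃) (G₁ ∪ G₂) =
      (m⟦p, (G₁ ∩ G₂) ∪ (G₁ ∩ G₃) ∪ (G₂ ∩ G₃)⟧ + m⟦p, (G₁ ∪ G₂ ∪ G₃)ᶜ⟧) *
          (m⟦p, (G₁ ∩ G₂) ∪ (G₁ ∩ G₃) ∪ (G₂ ∩ G₃)⟧ * m⟦p, (G₁ ∪ G₂ ∪ G₃)ᶜ⟧
            - (m⟦p, G₂ \ (G₁ ∪ G₃)⟧ * m⟦p, G₁ \ (G₂ ∪ G₃)⟧ + m⟦p, G₂ \ (G₁ ∪ G₃)⟧ * m⟦p, G₃ \ (G₁ ∪ G₂)⟧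
                + m⟦p, G₁ \ (G₂ ∪ G₃)⟧ * m⟦p, G₃ \ (G₁ ∪ G₂)⟧))
        - m⟦p, G₂ \ (G₁ ∪ G₃)⟧ * m⟦p, G₁ \ (G₂ ∪ G₃)⟧ * m⟦p, G₃ \ (G₁ ∪ G₂)⟧ := by
  obtain ⟨e3, e1, e2⟩ := coSunflower_privateParts G₁ G₂ G₃
  obtain ⟨ec, eo⟩ := coSunflower_coreOutside G₁ G₂ G₃
  simp only [strongCubicPlus]
  rw [e1, e2, e3, ec, eo]

end SahiDeepCore

end Summit.CriticalPhenomena.PercolationContinuityZ3.Theorems
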